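import Mathlib
import Literature.Computability.QuantumComplexity.StabilizerRank
import Literature.Computability.QuantumComplexity.ApproxStabilizerRankTypicalProofs
import HarnessLib

/-!
# The affine/quadratic-form expansion of stabilizer states and their number

Topic `Computability/QuantumComplexity`; namespace `Literature.Computability.QuantumComplexity`.

Two classical facts about the `n`-qubit stabilizer states, stated for the tree's *operational*
definition `stabilizerStates n` (`StabilizerRank.lean`: the orbit of `|0ⁿ⟩` under the monoid
generated by placements of `H`, `S`, `CNOT`; this set is closed under the global phases
`ω^k`, `ω = e^{iπ/4}`, since `(SH)³ = ω·1`):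

1. **Dehaene–De Moor (2003), Thm 5 / Van den Nest (2010), eq. (3)** — the computational-basis
   expansion: every `ψ = C|0ⁿ⟩` (`C` a Clifford circuit) satisfies
   `ψ ∝ Σ_{x ∈ A} i^{l(x)} (-1)^{q(x)} |x⟩` with `A ⊆ 𝔽₂ⁿ` an affine subspace, `l` a linear and
   `q` a quadratic function on `𝔽₂ⁿ` (`q(x) = Σ cᵢⱼ xᵢ xⱼ + Σ cᵢ xᵢ`; the exponent `l(x)` of `i` is
   computed modulo `2`), "Conversely, every state of the form (3) is a stabilizer state"
   (Van den Nest, §5). The (⇒) direction is ALREADY PROVED in the tree, in the Dehaene–De Moor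
   `ℤ₄`-phase parametrisation: `ApproxRankTypical.repr_of_mem_stabilizerStates` /
   `ApproxRankTypical.exists_param_of_mem_stabilizerStates` (`ApproxStabilizerRankTypicalProofs.lean`:
   every `ψ ∈ stabilizerStates n` is `c • vec P`, `vec P x = [toV x − a ∈ span v] · i^{qf l q x}`,
   `qf = Σ λᵢxᵢ + 2Σ q_{ik}xᵢx_k ∈ ℤ₄`, interconvertible with `i^{l(x) mod 2}(−1)^{q(x)}` by
   `i^{Σ aᵢxᵢ} = i^{(Σ aᵢxᵢ) mod 2}(−1)^{Σ_{i<k} aᵢa_kxᵢx_k}`, `i^{2x} = (−1)^x`), together with the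
   finite count `card_param`; we only re-derive from it that all non-zero amplitudes of a stabilizer
   state have equal modulus. What is vendored here as a named fact is the genuinely unproved
   CONVERSE, as printed and *up to a non-zero scalar* (`∝`, the form relevant for stabilizer
   ranks): `VanDenNest2010_expansion_converse`.
2. **Aaronson–Gottesman (2004), Proposition 2** — the number of pure `n`-qubit stabilizer states
   is `N = 2ⁿ ∏_{k=0}^{n-1} (2^{n-k} + 1)` (`6, 60, 1080, 36720, …`); with their Theorem 1 (i)
   ("obtained from `|0⟩^{⊗n}` by CNOT, Hadamard, and phase gates only") a pure stabilizer state is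
   exactly a ray `ℂψ`, `ψ ∈ stabilizerStates n`: named fact `AaronsonGottesman2004_prop2`, counting
   the set of lines `ℂ ∙ ψ`.

Both are wanted by route `MatrixMultiplication/StabilizerTensorRank` (they turn a bound
`χ(ψ) ≤ r` into a finite search). Proofs (graph-state preparation for (⇐); invariance of the class
of expansions under `H`, `S`, `CNOT` placements, Van den Nest App. A, for (⇒); the counting) are
not given here — these are `provefact` targets over the tree's `placeGate` calculus.

## Conventions

* `𝔽₂ⁿ` is `Fin n → ZMod 2` (the tree's `ApproxRankTypical.V n`); a basis label
  `x : QReg n = Fin n → Bool` is read in `𝔽₂ⁿ` by the tree's `ApproxRankTypical.toV`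
  (`false ↦ 0`, `true ↦ 1`).
* Affine subspaces are Mathlib's `AffineSubspace (ZMod 2) (Fin n → ZMod 2)` (which includes `⊥ = ∅`;
  the converse direction therefore assumes `A` non-empty — the empty sum is the zero vector, not a
  state). Linear functions are `(Fin n → ZMod 2) →ₗ[ZMod 2] ZMod 2`; quadratic functions are given
  by a coefficient matrix `c`, `quadFun c x = Σᵢ Σⱼ cᵢⱼ xᵢ xⱼ` (diagonal = linear terms, as
  `xᵢ² = xᵢ`), literally Van den Nest's "`q(x) = Σ cᵢⱼ xᵢxⱼ + cᵢxᵢ`".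
* `i^{l(x)}`, `(-1)^{q(x)}` are `Complex.I ^ (l x).val`, `(-1) ^ (q x).val` (`ZMod.val ∈ {0, 1}`).

## References

* [DehaeneDemoor2003] J. Dehaene, B. De Moor, *Clifford group, stabilizer states, and linear and
  quadratic operations over GF(2)*, Phys. Rev. A 68 (2003) 042318 (arXiv:quant-ph/0304125),
  Theorem 5 (held text `paper:arxiv-quant-ph_0304125`, chunk 9).
* [Vandennest2010] M. Van den Nest, *Classical simulation of quantum computation, the
  Gottesman–Knill theorem, and slightly beyond*, Quantum Inf. Comput. 10 (2010) 258–271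
  (arXiv:0811.0898), §5, eq. (3) and the sentence following it; App. A (held text
  `paper:arxiv-0811.0898`, chunks 7, 12).
* [AaronsonGottesman2004] S. Aaronson, D. Gottesman, *Improved simulation of stabilizer circuits*,
  Phys. Rev. A 70 (2004) 052328 (arXiv:quant-ph/0406196), Theorem 1 and Proposition 2 (held text
  `paper:arxiv-quant-ph_0406196`, chunks 5–6).
-/

noncomputable section

namespace Literature.Computability.QuantumComplexity

open Cryptography

/-! ### The affine/quadratic vectors -/

open ApproxRankTypical (toV)

/-- The **quadratic function** on `𝔽₂ⁿ` with coefficient matrix `c`: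
`q(x) = Σᵢ Σⱼ cᵢⱼ xᵢ xⱼ` (the diagonal carries the linear terms since `xᵢ² = xᵢ` in `𝔽₂`).
[cite: Vandennest2010, §5 eq. (3)] -/
def quadFun {n : ℕ} (c : Fin n → Fin n → ZMod 2) (x : Fin n → ZMod 2) : ZMod 2 :=
  ∑ i, ∑ j, c i j * x i * x j

open Classical in
/-- The vector `Σ_{x ∈ A} i^{l(x)} (-1)^{q(x)} |x⟩` of Dehaene–De Moor / Van den Nest, eq. (3):
amplitude `i^{l(x)} (-1)^{q(x)}` on the affine subspace `A ⊆ 𝔽₂ⁿ` and `0` outside (`l` linear,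
`q = quadFun c`; `l(x)` taken in `{0,1}` before exponentiating `i`).
[cite: Vandennest2010, §5 eq. (3)] -/
def affineQuadraticVector {n : ℕ} (A : AffineSubspace (ZMod 2) (Fin n → ZMod 2))
    (l : (Fin n → ZMod 2) →ₗ[ZMod 2] ZMod 2) (c : Fin n → Fin n → ZMod 2) : QReg n → ℂ :=
  fun x => if toV x ∈ A then Complex.I ^ (l (toV x)).val * (-1 : ℂ) ^ (quadFun c (toV x)).val
    else 0

/-- On the full space with trivial `l`, `q` the vector is the all-ones vector `Σ_x |x⟩`
(`= √2ⁿ · H^{⊗n}|0ⁿ⟩`). [folklore] -/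
theorem affineQuadraticVector_top_zero {n : ℕ} (x : QReg n) :
    affineQuadraticVector (⊤ : AffineSubspace (ZMod 2) (Fin n → ZMod 2)) 0 0 x = 1 := by
  simp [affineQuadraticVector, quadFun]

/-! ### Named facts -/

/-- **Van den Nest 2010, §5, eq. (3), the converse** ("Conversely, every state of the form (3) is
a stabilizer state"; Dehaene–De Moor 2003, Thm. 5): for a non-empty affine subspace `A ⊆ ℤ₂ⁿ`,
a linear `l` and a quadratic `q = quadFun c`, some non-zero complex multiple of
`Σ_{x∈A} i^{l(x)} (-1)^{q(x)} |x⟩` lies in the tree's operational `stabilizerStates n` (Clifford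
orbit of `|0ⁿ⟩`; "is a stabilizer state" = up to normalisation and phase). The direct half
(every stabilizer state is `∝` such a vector) is the tree's PROVED
`ApproxRankTypical.exists_param_of_mem_stabilizerStates` and is not restated as debt.
[cite: Vandennest2010, §5 eq. (3) (Conversely)] -/
def VanDenNest2010_expansion_converse : Prop :=
  ∀ (n : ℕ) (A : AffineSubspace (ZMod 2) (Fin n → ZMod 2)) (l : (Fin n → ZMod 2) →ₗ[ZMod 2] ZMod 2)
    (c : Fin n → Fin n → ZMod 2), (A : Set (Fin n → ZMod 2)).Nonempty →
      ∃ γ : ℂ, γ ≠ 0 ∧ γ • affineQuadraticVector A l c ∈ stabilizerStates n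

/-- **Aaronson–Gottesman 2004, Proposition 2.** "Let `N` be the number of pure stabilizer states
on `n` qubits. Then `N = 2ⁿ ∏_{k=0}^{n-1} (2^{n-k} + 1) = 2^{(1/2+o(1))n²}`." With their Theorem 1
(i) a pure stabilizer state is a ray `ℂψ` with `ψ ∈ stabilizerStates n` (Clifford circuit applied
to `|0ⁿ⟩`), so the set of lines `ℂ ∙ ψ`, `ψ ∈ stabilizerStates n`, has exactly
`2ⁿ ∏_{k<n} (2^{n-k} + 1)` elements (`1, 6, 60, 1080, 36720, …`; `Set.ncard`, so the statement
includes finiteness). [cite: AaronsonGottesman2004, Proposition 2] -/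
def AaronsonGottesman2004_prop2 : Prop :=
  ∀ n : ℕ,
    {L : Submodule ℂ (QReg n → ℂ) | ∃ ψ ∈ stabilizerStates n, L = ℂ ∙ ψ}.ncard =
      2 ^ n * ∏ k ∈ Finset.range n, (2 ^ (n - k) + 1)

/-! ### Small consequences -/

/-- The counting formula evaluates to `6` for one qubit. [cite: AaronsonGottesman2004, Proposition 2] -/
theorem stabilizer_count_one : 2 ^ 1 * ∏ k ∈ Finset.range 1, (2 ^ (1 - k) + 1) = 6 := by
  decide

/-- … and to `60`, `1080`, `36720` for `n = 2, 3, 4`. [cite: AaronsonGottesman2004, Proposition 2] -/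
theorem stabilizer_count_two_three_four :
    2 ^ 2 * ∏ k ∈ Finset.range 2, (2 ^ (2 - k) + 1) = 60 ∧
    2 ^ 3 * ∏ k ∈ Finset.range 3, (2 ^ (3 - k) + 1) = 1080 ∧
    2 ^ 4 * ∏ k ∈ Finset.range 4, (2 ^ (4 - k) + 1) = 36720 := by
  decide

/-- From the converse: the all-ones vector `Σ_x |x⟩` is, up to a non-zero scalar, a stabilizer
state. [cite: Vandennest2010, §5 eq. (3) (Conversely)] -/
theorem exists_smul_ones_mem_stabilizerStates (h : VanDenNest2010_expansion_converse) (n : ℕ) :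
    ∃ γ : ℂ, γ ≠ 0 ∧ (γ • fun _ : QReg n => (1 : ℂ)) ∈ stabilizerStates n := by
  obtain ⟨γ, hγ, hmem⟩ := h n ⊤ 0 0 (by simp)
  refine ⟨γ, hγ, ?_⟩
  have : (affineQuadraticVector (⊤ : AffineSubspace (ZMod 2) (Fin n → ZMod 2)) 0 0) =
      fun _ : QReg n => (1 : ℂ) := funext affineQuadraticVector_top_zero
  rwa [this] at hmem

/-- The phases `i^a` of the Dehaene–De Moor family have modulus one. [folklore] -/
theorem norm_phase (a : ZMod 4) : ‖ApproxRankTypical.phase a‖ = 1 := by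
  simp [ApproxRankTypical.phase]

/-- **All non-zero amplitudes of a stabilizer state have the same modulus** — unconditional, from
the tree's proved normal form `ApproxRankTypical.exists_param_of_mem_stabilizerStates`
(`ψ = c • vec P`, the non-zero values of `vec P` being powers of `i`).
[cite: DehaeneDemoor2003, Thm. 5] -/
theorem norm_eq_of_mem_stabilizerStates {n : ℕ} {ψ : QReg n → ℂ} (hψ : ψ ∈ stabilizerStates n)
    {x y : QReg n} (hx : ψ x ≠ 0) (hy : ψ y ≠ 0) : ‖ψ x‖ = ‖ψ y‖ := by
  classical
  obtain ⟨P, c, rfl⟩ := ApproxRankTypical.exists_param_of_mem_stabilizerStates hψ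
  have key : ∀ z : QReg n, (c • ApproxRankTypical.vec P) z ≠ 0 →
      ‖(c • ApproxRankTypical.vec P) z‖ = ‖c‖ := by
    intro z hz
    simp only [Pi.smul_apply, smul_eq_mul, ApproxRankTypical.vec] at hz ⊢
    split_ifs at hz ⊢ with hmem
    · rw [norm_mul, norm_phase, mul_one]
    · simp at hz
  rw [key x hx, key y hy]

end Literature.Computability.QuantumComplexity
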